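/-
COR-CM (cell pub-hodgecm2, stage 2 of the Hodge ladder) — junction B01 `PerLFace_of_PerL`: at degree 6 every face has an
INDUCED period type.  Statement and proof typed by the ideation seat planner-pub-hodgecm2-b01-idea-2-0 (lens 2,
`HOME/b01/IDEA-2-Sketch.lean` (W)/(W′), 2026-08-21); filed by the single owner of B01, prover-pub-hodgecm2-own-b01-0
(ROUTES-B01.md v2 §7).  Theorems only; nothing cited, nothing asserted.
-/
import Summits.HodgeConjecture.CorCM.CyclicSexticInducedType
import HarnessLib

/-!
# Every rank-four face of a Galois sextic CM field has a period type induced from its imaginary quadratic subfield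

`Universe.PeriodThmF` (`= PerLFace`, the B01 target) ranges over ALL Galois CM fields `F` with `6 ≤ [F:ℚ]` and all
rank-four faces `f`, whose four PERIOD types `f.psi i` (`CorCM/CM/Basic.lean`: `Φ, Φ^{(ππ′)}, Φ^{(π)}, Φ^{(π′)}`) index the
CM abelian varieties `A_{(F, ψ_i)}` of the period integral.  A Galois sextic CM field is cyclic with generator `σ` of
order `6`, `σ³ =` complex conjugation (`CyclicSextic.exists_generator`), and exactly one CORNER of every face is
`σ²`-stable (`CyclicSextic.face_corner_pattern`).  Through the corner/period dictionary (`psi 0 = corner 0`,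
`psi 1 = corner 3`, `psi 2 = bar (corner 1)`, `psi 3 = bar (corner 2)`) and `cmTypeMap e (bar Φ) = bar (cmTypeMap e Φ)`:

* `Face.psi_exists_sq_stable` — for every face `f` of a Galois sextic CM field some period type `f.psi i` is
  `σ²`-stable;
* `Face.psi_exists_eq_inducedCMType` — hence that period type is INDUCED (`inducedCMType`) from a CM type `Φ₀` of the
  imaginary quadratic subfield `k = F^{⟨σ²⟩}` (`CyclicSextic.exists_inducedCMType_of_sq_stable`); so `A_{(F, ψ_i)}` is
  isogenous to the cube of the CM elliptic curve `A_{(k, Φ₀)}` and the double reflex of `(F, ψ_i)` is `(k, Φ₀)`, not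
  `(F, ψ_i)`.

USE (ROUTES-B01.md v2 §5/§7): the stage-1 Liu junction (`LiuCMSide.IsCorner`, ISO form, discharged from primitivity at
sextic scope) cannot be instantiated at that slot of ANY degree-6 instance of `PeriodThmF`; a face-scoped end state must
type the corner match with an EMBEDDING of the double reflex («sub-corner socket»), which the package's common-reflex
layer already inflates.  Nothing here restates `PerL` / `PerLFace` / B01.
-/

noncomputable section

namespace Summit.HodgeConjecture.CorCM

open NumberField
open Literature.AlgebraicGeometry.Motives (CMType)
open Literature.NumberTheory.ComplexMultiplication (inducedCMType)
open Literature.NumberTheory.ComplexMultiplication.CMTypeOps (bar flip placeSet mem_bar_iff mem_flip_iff)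
open Literature.NumberTheory.Automorphic.PicardCM.CMCode (cmTypeMap mem_cmTypeMap_iff)

namespace Face

variable {K E : Type} [Field K] [Field E]

/-- Flipping at a place commutes with passing to the conjugate type: `(Φ̄)^{(π)} = \overline{Φ^{(π)}}`. [folklore] -/
theorem flip_bar (p : K →+* ℂ) (Φ : CMType K) : flip p (bar Φ) = bar (flip p Φ) := by
  apply Subtype.ext; ext φ
  rw [mem_flip_iff, mem_bar_iff, mem_bar_iff, mem_flip_iff]
  by_cases h1 : φ ∈ Φ.1 <;> by_cases h2 : φ ∈ placeSet p <;> simp [h1, h2]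

/-- Transport along a field isomorphism commutes with passing to the conjugate type. [folklore] -/
theorem cmTypeMap_bar (e : K ≃+* E) (Φ : CMType K) : cmTypeMap e (bar Φ) = bar (cmTypeMap e Φ) :=
  Subtype.ext (Set.ext fun _ => Iff.rfl)

/-- A type is stable under an automorphism iff its conjugate type is. [folklore] -/
theorem cmTypeMap_bar_eq_bar_iff (e : K ≃+* K) (Φ : CMType K) :
    cmTypeMap e (bar Φ) = bar Φ ↔ cmTypeMap e Φ = Φ := by
  rw [cmTypeMap_bar]
  constructor
  · intro h
    have h' := congrArg bar h
    have hbb : ∀ Ψ : CMType K, bar (bar Ψ) = Ψ := fun Ψ => Subtype.ext (compl_compl Ψ.1)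
    rwa [hbb, hbb] at h'
  · intro h; rw [h]

/-- **At degree 6 every face has a `σ²`-stable PERIOD type**: for a Galois sextic CM field `K` and every rank-four
face `f` there are a generator `σ` of `Gal(K/ℚ)` (order `6`) and a slot `i` with `(σ²)·ψ_i = ψ_i`.  (From
`CyclicSextic.face_corner_pattern`: exactly one corner is `σ²`-stable, and the period types are the corners up to
conjugation, which commutes with `σ²`.) [folklore] -/
theorem psi_exists_sq_stable {K : Type} [Field K] [NumberField K] [IsCMField K] [IsGalois ℚ K]
    (h6 : Module.finrank ℚ K = 6) (f : Face K) :
    ∃ (σ : K ≃ₐ[ℚ] K) (i : Fin 4), orderOf σ = 6 ∧ cmTypeMap (σ ^ 2).toRingEquiv (f.psi i) = f.psi i := by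
  obtain ⟨σ, hσ, h3⟩ := CyclicSextic.exists_generator (K := K) h6
  obtain ⟨j₀, j₁, j₂, j₃, -, h0, -, -, -⟩ := CyclicSextic.face_corner_pattern σ h6 hσ h3 f
  fin_cases j₀
  · exact ⟨σ, 0, hσ, by simpa [Face.corner, Face.psi] using h0⟩
  · refine ⟨σ, 2, hσ, ?_⟩
    simp only [Face.corner, Face.psi] at h0 ⊢
    rw [flip_bar] at h0
    exact (cmTypeMap_bar_eq_bar_iff _ _).mp h0
  · refine ⟨σ, 3, hσ, ?_⟩
    simp only [Face.corner, Face.psi] at h0 ⊢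
    rw [flip_bar] at h0
    exact (cmTypeMap_bar_eq_bar_iff _ _).mp h0
  · exact ⟨σ, 1, hσ, by simpa [Face.corner, Face.psi] using h0⟩

/-- **At degree 6 every face has an INDUCED period type**: for a Galois sextic CM field `K` and every rank-four face
`f`, some period type `ψ_i` is `inducedCMType (algebraMap k K) Φ₀` for a CM type `Φ₀` of the imaginary quadratic
subfield `k = K^{⟨σ²⟩}` (so `A_{(K, ψ_i)}` is isogenous to the cube of a CM elliptic curve, and the double reflex of
`(K, ψ_i)` is `(k, Φ₀)`). [folklore] -/
theorem psi_exists_eq_inducedCMType {K : Type} [Field K] [NumberField K] [IsCMField K] [IsGalois ℚ K]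
    (h6 : Module.finrank ℚ K = 6) (f : Face K) :
    ∃ (σ : K ≃ₐ[ℚ] K) (i : Fin 4) (_ : orderOf σ = 6)
      (Φ₀ : CMType (IntermediateField.fixedField (Subgroup.zpowers (σ ^ 2)))),
      f.psi i = inducedCMType (algebraMap (IntermediateField.fixedField (Subgroup.zpowers (σ ^ 2))) K) Φ₀ := by
  obtain ⟨σ, i, hσ, hst⟩ := psi_exists_sq_stable h6 f
  obtain ⟨Φ₀, hΦ₀⟩ := CyclicSextic.exists_inducedCMType_of_sq_stable σ (f.psi i) hst
  exact ⟨σ, i, hσ, Φ₀, hΦ₀⟩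

end Face

end Summit.HodgeConjecture.CorCM

end
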